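import Summits.QuantumFields.BalabanUV.Beta.GAN24.MixedChannelBondSums
import Summits.QuantumFields.BalabanUV.Beta.GAN24.ExchangeReadout
import Summits.QuantumFields.BalabanUV.Beta.GAN24.TransversalZeroModeLoc

/-!
# `BalabanUV.Beta.GAN24.WSlotSourceZeroMode` — binder row G-an2-4 ∕ (CONV-C), W-slot road «W3» (gan24-p1 `SKELETON-W3.md` v1.0.2 §8.3),
# ROW W3-F2a `hZ : ∀ m, Zfree (b m)` (typer `GAN24/Formal/LEAVES.md` v3.11 § IV-C; journal INTENT «W3-ZS*» l.9181) — THE ASSEMBLY: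
# the value part of leaf-04's literal bracket is a finite signed sum of six sandwiched CHANNELS (two exchange trees, two mixed bi-vertices,
# two halves of the second-response term) and the border has no field–field entries, so the transversal ff zero mode of `b m` is the sum
# of six channel zero modes

NOT IN PRINT; OUR BOOKKEEPING (G-an2-4 formalisation swarm, leaf prover `b2b-balaban-gan24-formalise-leaf-20`, gen 18; name PROVISIONAL — the
row owner gan24-p1 may rename ∕ re-home it).  HONEST FRAMING (cell contract, verbatim): «discharging `BetaPertH` makes Bałaban's UV stability
UNCONDITIONAL — a real constructive-QFT result; it is NOT the continuum limit and NOT the Clay problem.»  HONEST DEPENDENCY (verbatim):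
«continuum YM on T⁴ ⇐ BetaPertH ∧ nine spine estimates (0/9 proved); BetaPertH ⇐ (D1) ∧ (D4) ∧ CAP+tail; G-an2-4 gates asym, D1 and NE2/3/4.»

THE OBJECT.  leaf-04's affine split `T2RecursionAffine.unitS₂_T2Of_succ_affine` (p212454) writes the normalised member `j+1` of an2's
bi-stencil family as `b_j + lin4 (cE₂·Lc^{2(d+1)}) K♮_j Lc T♮_j` with the SOURCE (bracket)
`b_j κ u κ′ u′ = (cE₂·Lc^{2(d+1)}) • mmRead Lc (K3OfK K♮_j Lc S♮_j M♮_j (W2SymOfK K♮_j Lc S♮_j M♮_j 0 M₂♮_j) κ u κ′ u′) + cB • mfNeg (vh₂S κ u κ′ u′)`.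
ROW W3-F2a asks `∀ j, Zfree (b_j)` — in the pointwise transversal form of record (ref2 R51-2∕(w2)):
`∀ κ u κ′ α β, Σ'_{u′} Σ'_{x} Σ'_{z} b_j κ u κ′ u′ x z (inl α) (inl β) = 0`, and in leaf-02's cell form `zmode Lc (b_j) κ κ′ (inl α) (inl β) = 0`.

WHAT ([folklore] kernel algebra + Fubini bookkeeping over TREE objects BY NAME; generic `d`, `N`; 0 cite, 0 `def … : Prop`, 0 sorry):
* §1 `W2SymOfK_zero_eq` — `W2SymOfK K N S M 0 M₂ b b′ = mixOfK b b′ + mixOfK b′ b + ½•dM (K2OfK … b′) … b + ½•dM (K2OfK … b) … b′`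
  (pure algebra: `W2OfK_apply` + leaf-04's `vertex2OfK_zero`);
* §2 `sandwich_W2SymOfK_zero_eq` — `K ∘ W₀ b b′ ∘ K` splits into the four sandwiched channels (an5's `Tame` calculus: `comp_add_*_tame`,
  `comp_smul_*`; hypotheses `Spr K`, `Loc` of the pieces); `K3OfK_W2SymOfK_zero_ff` — the ENTRY formula: the value part's `mm` entry is
  `E₁ + E₂ − X₁ − X₂ − ½R₁ − ½R₂` (leaf-06's `ExchangeReadout.K3OfK_apply_eq` for the two exchange trees);
* §3 `inner_add₃`∕`inner_sub₃`∕`inner_smul₃` — additivity of the transversal triple sum from PRODUCT summability on `Site × (Site × Site)`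
  (leaf-16's `TransversalZeroMode.inner_add_eq` with its six nested summabilities discharged by `Summable.prod_factor`∕`.prod`);
* §4 **`inner_value_eq_zero_of_channels`** — THE ASSEMBLY (END-as-function): if each of the six channels, read through `mmRead N (K ∘ · ∘ K)`,
  is product-summable in `(u′, (x, z))` on the ff slot and has transversal inner sum `0` at the first bond `(κ, u)`, then so has the value part;
* §5 `sandwich_transfer` — SANDWICH TRANSFER: for a decaying `K` with site-free coarse-leg charges of leaf-06's `Sum.elim` shape and a bond
  family of LOCALISED kernels whose ff double-leg sums have a bond series with `HasSum` zero, the sandwiched `mm`-read family is in the pair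
  currency of §4 with `HasSum` zero (leaf-06's `ResolventLegCharges.hasSum_sandwich_readout` + `StepResolventLegCharges.sum_elim_charges`).
Part B (`GAN24/WSlotSourceZeroModeStep`) instantiates at the step kernel `K♮_j = unitK s_f s_m (KInvStep Lc j)` and at leaf-04's LITERAL bracket,
discharging the mixed channel and the `W`-term reduction by leaf-14's tree theorems (`MixedChannelBondSums`, (S2c)) and keeping the two
exchange + two second-response ff double-leg bond sums (leaf-06-g9's announced «W3-S3C*» PART 6, journal l.9159) as hypotheses.
HONEST: assembly only; discharges nothing of ROW W3-F2a by itself; NOT «T2Shape», NOT (hW, hWall), 0∕2 wall binders; NOT «W-slot closed» (nor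
under an undischarged pin), NEVER «G-an2-4 closed»; NOT BetaPertH, NOT continuum, NOT Clay.
-/

noncomputable section

open Finset
open scoped BigOperators
open Literature.MathematicalPhysics.QuantumFieldTheory
open Literature.MathematicalPhysics.QuantumFieldTheory.Balaban1983to89
open Literature.MathematicalPhysics.QuantumFieldTheory.Balaban1983to89.Beta
open AffineAveraging (Site)
open B12Sec2to5 (l1)
open ExpKernelCalculus (MKer Decays BiLoc VertexFamily comp shiftK)
open OneStepResolventKernel (Fib LocStencil)
open OneStepKernelFamily (KInvStep decays_KInvStep)
open SecondOrderResponse (dM K2OfK vertex2OfK mixOfK W2OfK W2SymOfK W2OfK_apply LocStencilFM)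
open BalabanStepW2 (K3OfK)
open BalabanStepJetsSucc (mmRead mmRead_inl_inl)

open Summit.QuantumFields.BalabanUV.Beta.HessKerDressedUnits (unitK decays_unitK)
open Summit.QuantumFields.BalabanUV.Beta.TameKernelCalculus (Spr Loc Tame comp_add_right_tame comp_add_left_tame comp_neg_right)
open Summit.QuantumFields.BalabanUV.Beta.GAN24.BiStencilZeroMode (Tab zmode)
open Summit.QuantumFields.BalabanUV.Beta.GAN24.TransversalZeroMode (zmode_eq_zero_of_inner_eq_zero)
open Summit.QuantumFields.BalabanUV.Beta.GAN24.ExchangeReadout (K3OfK_apply_eq)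
open Summit.QuantumFields.BalabanUV.Beta.GAN24.T2RecursionAffine (vertex2OfK_zero)

namespace Summit.QuantumFields.BalabanUV.Beta.GAN24.WSlotSourceZeroMode

variable {d : ℕ} {N : ℕ}

/-! ## §1 The `T`-free second-order family, pointwise -/

section Decomp

variable {K : MKer (d + 1) (Fib d)} {S M : Fin (d + 1) → Site (d + 1) → MKer (d + 1) (Fib d)}
  {M₂ : Fin (d + 1) → Site (d + 1) → Fin (d + 1) → Site (d + 1) → MKer (d + 1) (Fib d)}

/-- [folklore] **THE `T`-FREE SECOND-ORDER FAMILY IS TWO MIXED BI-VERTICES PLUS THE SYMMETRISED SECOND-RESPONSE TERM**: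
`W2SymOfK K N S M 0 M₂ b b′ = mixOfK K N M₂ b b′ + mixOfK K N M₂ b′ b + ½•dM (K2OfK K N S M b′) N S M b + ½•dM (K2OfK K N S M b) N S M b′`
(`W2SymOfK = ½•(W2OfK b b′ + W2OfK b′ b)`, `W2OfK_apply`, and the bi-vertex of the zero table is `0` — leaf-04's `vertex2OfK_zero`). -/
theorem W2SymOfK_zero_eq (μ : Fin (d + 1)) (y : Site (d + 1)) (ν : Fin (d + 1)) (y' : Site (d + 1)) :
    W2SymOfK K N S M 0 M₂ μ y ν y' =
      mixOfK K N M₂ μ y ν y' + mixOfK K N M₂ ν y' μ y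
        + (1 / 2 : ℝ) • dM (K2OfK K N S M ν y') N S M μ y + (1 / 2 : ℝ) • dM (K2OfK K N S M μ y) N S M ν y' := by
  unfold W2SymOfK
  rw [W2OfK_apply, W2OfK_apply, vertex2OfK_zero, vertex2OfK_zero]
  funext x z a b
  simp only [Pi.smul_apply, Pi.add_apply, Pi.zero_apply, smul_eq_mul]
  ring

/-! ## §2 The sandwich of the `T`-free family splits into four sandwiched channels; the entry formula of the value part -/

/-- [folklore] **THE SANDWICH SPLITS** (an5's `Tame` calculus: every composition series below converges absolutely because `K` is spread and
each channel is localised): `K ∘ W2SymOfK K N S M 0 M₂ b b′ ∘ K = K∘mixOfK b b′∘K + K∘mixOfK b′ b∘K + ½•K∘dM(K2OfK b′) b∘K + ½•K∘dM(K2OfK b) b′∘K`. -/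
theorem sandwich_W2SymOfK_zero_eq (hK : Spr K) (hmix : ∀ μ y ν y', Loc (mixOfK K N M₂ μ y ν y'))
    (hresp : ∀ μ y ν y', Loc (dM (K2OfK K N S M ν y') N S M μ y))
    (μ : Fin (d + 1)) (y : Site (d + 1)) (ν : Fin (d + 1)) (y' : Site (d + 1)) :
    comp (comp K (W2SymOfK K N S M 0 M₂ μ y ν y')) K =
      comp (comp K (mixOfK K N M₂ μ y ν y')) K + comp (comp K (mixOfK K N M₂ ν y' μ y)) K
        + (1 / 2 : ℝ) • comp (comp K (dM (K2OfK K N S M ν y') N S M μ y)) K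
        + (1 / 2 : ℝ) • comp (comp K (dM (K2OfK K N S M μ y) N S M ν y')) K := by
  rw [W2SymOfK_zero_eq]
  have tK : Tame K := hK.tame
  have lA : Loc (mixOfK K N M₂ μ y ν y') := hmix μ y ν y'
  have lB : Loc (mixOfK K N M₂ ν y' μ y) := hmix ν y' μ y
  have lC : Loc ((1 / 2 : ℝ) • dM (K2OfK K N S M ν y') N S M μ y) := (hresp μ y ν y').smul _
  have lD : Loc ((1 / 2 : ℝ) • dM (K2OfK K N S M μ y) N S M ν y') := (hresp ν y' μ y).smul _
  -- distribute the inner `K ∘ (·)`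
  have e1 : comp K (mixOfK K N M₂ μ y ν y' + mixOfK K N M₂ ν y' μ y
        + (1 / 2 : ℝ) • dM (K2OfK K N S M ν y') N S M μ y + (1 / 2 : ℝ) • dM (K2OfK K N S M μ y) N S M ν y')
      = comp K (mixOfK K N M₂ μ y ν y') + comp K (mixOfK K N M₂ ν y' μ y)
        + comp K ((1 / 2 : ℝ) • dM (K2OfK K N S M ν y') N S M μ y) + comp K ((1 / 2 : ℝ) • dM (K2OfK K N S M μ y) N S M ν y') := by
    rw [comp_add_right_tame tK ((lA.add lB).add lC).tame lD.tame, comp_add_right_tame tK (lA.add lB).tame lC.tame,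
      comp_add_right_tame tK lA.tame lB.tame]
  rw [e1]
  -- distribute the outer `(·) ∘ K`
  have mA : Loc (comp K (mixOfK K N M₂ μ y ν y')) := hK.comp_loc lA
  have mB : Loc (comp K (mixOfK K N M₂ ν y' μ y)) := hK.comp_loc lB
  have mC : Loc (comp K ((1 / 2 : ℝ) • dM (K2OfK K N S M ν y') N S M μ y)) := hK.comp_loc lC
  have mD : Loc (comp K ((1 / 2 : ℝ) • dM (K2OfK K N S M μ y) N S M ν y')) := hK.comp_loc lD
  rw [comp_add_left_tame ((mA.add mB).add mC).tame mD.tame tK, comp_add_left_tame (mA.add mB).tame mC.tame tK,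
    comp_add_left_tame mA.tame mB.tame tK, KernelReflection.comp_smul_right, KernelReflection.comp_smul_right,
    KernelReflection.comp_smul_left, KernelReflection.comp_smul_left]

/-- [folklore] **THE ENTRY FORMULA OF THE VALUE PART**: for every entry, the `mm`-read of an2's second response-derivative on the `T`-free
family is `E₁ + E₂ − X₁ − X₂ − ½R₁ − ½R₂` — two exchange trees (`ExchangeReadout.K3OfK_apply_eq`), two sandwiched mixed bi-vertices, two
sandwiched second-response halves. -/
theorem K3OfK_W2SymOfK_zero_ff (hK : Spr K) (hmix : ∀ μ y ν y', Loc (mixOfK K N M₂ μ y ν y'))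
    (hresp : ∀ μ y ν y', Loc (dM (K2OfK K N S M ν y') N S M μ y))
    (μ : Fin (d + 1)) (y : Site (d + 1)) (ν : Fin (d + 1)) (y' : Site (d + 1)) (x z : Site (d + 1)) (α β : Fin (d + 1)) :
    mmRead N (K3OfK K N S M (W2SymOfK K N S M 0 M₂) μ y ν y') x z (Sum.inl α) (Sum.inl β) =
      mmRead N (comp (comp K (dM K N S M μ y)) (comp (comp K (dM K N S M ν y')) K)) x z (Sum.inl α) (Sum.inl β)
      + mmRead N (comp (comp K (dM K N S M ν y')) (comp (comp K (dM K N S M μ y)) K)) x z (Sum.inl α) (Sum.inl β)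
      - mmRead N (comp (comp K (mixOfK K N M₂ μ y ν y')) K) x z (Sum.inl α) (Sum.inl β)
      - mmRead N (comp (comp K (mixOfK K N M₂ ν y' μ y)) K) x z (Sum.inl α) (Sum.inl β)
      - (1 / 2 : ℝ) * mmRead N (comp (comp K (dM (K2OfK K N S M ν y') N S M μ y)) K) x z (Sum.inl α) (Sum.inl β)
      - (1 / 2 : ℝ) * mmRead N (comp (comp K (dM (K2OfK K N S M μ y) N S M ν y')) K) x z (Sum.inl α) (Sum.inl β) := by
  simp only [mmRead_inl_inl]
  rw [K3OfK_apply_eq, sandwich_W2SymOfK_zero_eq hK hmix hresp]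
  simp only [Pi.add_apply, Pi.smul_apply, smul_eq_mul]
  ring

end Decomp

/-! ## §3 The transversal triple sum: pair form and additivity -/

section Triple

variable {F : Site (d + 1) → Site (d + 1) → Site (d + 1) → ℝ}

/-- [folklore] Under per-bond PAIR summability the transversal triple sum is the bond series of the pair sums:
`Σ'_{u′} Σ'_x Σ'_z F u′ x z = Σ'_{u′} Σ'_{(x,z)} F u′ x z` (`Summable.tsum_prod` member by member). -/
theorem inner_eq_tsum_pair (hp : ∀ u', Summable fun xz : Site (d + 1) × Site (d + 1) => F u' xz.1 xz.2) :
    (∑' u', ∑' x, ∑' z, F u' x z) = ∑' u', ∑' xz : Site (d + 1) × Site (d + 1), F u' xz.1 xz.2 :=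
  tsum_congr fun u' => ((hp u').tsum_prod).symm

/-- [folklore] **THE TRIPLE SUM OF A PAIR-SUMMABLE, BOND-NULL FAMILY VANISHES**: per-bond pair summability and `HasSum (u′ ↦ Σ'_{(x,z)} F u′ x z) 0`
give `Σ'_{u′} Σ'_x Σ'_z F u′ x z = 0`. -/
theorem inner_eq_zero_of_hasSum_pair (hp : ∀ u', Summable fun xz : Site (d + 1) × Site (d + 1) => F u' xz.1 xz.2)
    (hz : HasSum (fun u' => ∑' xz : Site (d + 1) × Site (d + 1), F u' xz.1 xz.2) 0) :
    (∑' u', ∑' x, ∑' z, F u' x z) = 0 := by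
  rw [inner_eq_tsum_pair hp]
  exact hz.tsum_eq

end Triple

/-! ## §4 The assembly: the value part's transversal zero mode is the signed sum of six channel zero modes -/

section Assembly

variable {K : MKer (d + 1) (Fib d)} {S M : Fin (d + 1) → Site (d + 1) → MKer (d + 1) (Fib d)}
  {M₂ : Fin (d + 1) → Site (d + 1) → Fin (d + 1) → Site (d + 1) → MKer (d + 1) (Fib d)}

/-- NOT IN PRINT; OUR BOOKKEEPING.  **THE ASSEMBLY OF ROW W3-F2a (END-as-function, generic kernel).**  Fix a first bond `(κ, u)`, a
second direction `κ′` and a field pair `(α, β)`.  Suppose each of the six CHANNELS of the value part — the two exchange trees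
`K∘dM_{(κ,u)}∘K∘dM_{(κ′,u′)}∘K`, `K∘dM_{(κ′,u′)}∘K∘dM_{(κ,u)}∘K`, the two sandwiched mixed bi-vertices `K∘mixOfK (κ,u) (κ′,u′)∘K`,
`K∘mixOfK (κ′,u′) (κ,u)∘K`, and the two sandwiched second-response halves `K∘dM (K2OfK (κ′,u′)) (κ,u)∘K`, `K∘dM (K2OfK (κ,u)) (κ′,u′)∘K` —
read through `mmRead N` on the `(inl α, inl β)` slot, is PAIR-SUMMABLE in `(x, z)` at every second bond `u′` and has bond series of pair sums
with `HasSum` ZERO.  Then the value part `mmRead N (K3OfK K N S M (W2SymOfK K N S M 0 M₂) κ u κ′ u′)` has transversal inner sum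
`Σ'_{u′} Σ'_x Σ'_z … (inl α) (inl β) = 0` (entry formula §2 + §3). -/
theorem inner_value_eq_zero_of_channels (hK : Spr K) (hmix : ∀ μ y ν y', Loc (mixOfK K N M₂ μ y ν y'))
    (hresp : ∀ μ y ν y', Loc (dM (K2OfK K N S M ν y') N S M μ y))
    (κ : Fin (d + 1)) (u : Site (d + 1)) (κ' α β : Fin (d + 1))
    (hpE₁ : ∀ u', Summable fun xz : Site (d + 1) × Site (d + 1) =>
      mmRead N (comp (comp K (dM K N S M κ u)) (comp (comp K (dM K N S M κ' u')) K)) xz.1 xz.2 (Sum.inl α) (Sum.inl β))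
    (hzE₁ : HasSum (fun u' => ∑' xz : Site (d + 1) × Site (d + 1),
      mmRead N (comp (comp K (dM K N S M κ u)) (comp (comp K (dM K N S M κ' u')) K)) xz.1 xz.2 (Sum.inl α) (Sum.inl β)) 0)
    (hpE₂ : ∀ u', Summable fun xz : Site (d + 1) × Site (d + 1) =>
      mmRead N (comp (comp K (dM K N S M κ' u')) (comp (comp K (dM K N S M κ u)) K)) xz.1 xz.2 (Sum.inl α) (Sum.inl β))
    (hzE₂ : HasSum (fun u' => ∑' xz : Site (d + 1) × Site (d + 1),
      mmRead N (comp (comp K (dM K N S M κ' u')) (comp (comp K (dM K N S M κ u)) K)) xz.1 xz.2 (Sum.inl α) (Sum.inl β)) 0)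
    (hpX₁ : ∀ u', Summable fun xz : Site (d + 1) × Site (d + 1) =>
      mmRead N (comp (comp K (mixOfK K N M₂ κ u κ' u')) K) xz.1 xz.2 (Sum.inl α) (Sum.inl β))
    (hzX₁ : HasSum (fun u' => ∑' xz : Site (d + 1) × Site (d + 1),
      mmRead N (comp (comp K (mixOfK K N M₂ κ u κ' u')) K) xz.1 xz.2 (Sum.inl α) (Sum.inl β)) 0)
    (hpX₂ : ∀ u', Summable fun xz : Site (d + 1) × Site (d + 1) =>
      mmRead N (comp (comp K (mixOfK K N M₂ κ' u' κ u)) K) xz.1 xz.2 (Sum.inl α) (Sum.inl β))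
    (hzX₂ : HasSum (fun u' => ∑' xz : Site (d + 1) × Site (d + 1),
      mmRead N (comp (comp K (mixOfK K N M₂ κ' u' κ u)) K) xz.1 xz.2 (Sum.inl α) (Sum.inl β)) 0)
    (hpR₁ : ∀ u', Summable fun xz : Site (d + 1) × Site (d + 1) =>
      mmRead N (comp (comp K (dM (K2OfK K N S M κ' u') N S M κ u)) K) xz.1 xz.2 (Sum.inl α) (Sum.inl β))
    (hzR₁ : HasSum (fun u' => ∑' xz : Site (d + 1) × Site (d + 1),
      mmRead N (comp (comp K (dM (K2OfK K N S M κ' u') N S M κ u)) K) xz.1 xz.2 (Sum.inl α) (Sum.inl β)) 0)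
    (hpR₂ : ∀ u', Summable fun xz : Site (d + 1) × Site (d + 1) =>
      mmRead N (comp (comp K (dM (K2OfK K N S M κ u) N S M κ' u')) K) xz.1 xz.2 (Sum.inl α) (Sum.inl β))
    (hzR₂ : HasSum (fun u' => ∑' xz : Site (d + 1) × Site (d + 1),
      mmRead N (comp (comp K (dM (K2OfK K N S M κ u) N S M κ' u')) K) xz.1 xz.2 (Sum.inl α) (Sum.inl β)) 0) :
    (∑' u', ∑' x, ∑' z, mmRead N (K3OfK K N S M (W2SymOfK K N S M 0 M₂) κ u κ' u') x z (Sum.inl α) (Sum.inl β)) = 0 := by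
  -- the entry formula, as an identity of families
  have hv : ∀ u' x z, mmRead N (K3OfK K N S M (W2SymOfK K N S M 0 M₂) κ u κ' u') x z (Sum.inl α) (Sum.inl β) =
      mmRead N (comp (comp K (dM K N S M κ u)) (comp (comp K (dM K N S M κ' u')) K)) x z (Sum.inl α) (Sum.inl β)
      + mmRead N (comp (comp K (dM K N S M κ' u')) (comp (comp K (dM K N S M κ u)) K)) x z (Sum.inl α) (Sum.inl β)
      - mmRead N (comp (comp K (mixOfK K N M₂ κ u κ' u')) K) x z (Sum.inl α) (Sum.inl β)
      - mmRead N (comp (comp K (mixOfK K N M₂ κ' u' κ u)) K) x z (Sum.inl α) (Sum.inl β)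
      - (1 / 2 : ℝ) * mmRead N (comp (comp K (dM (K2OfK K N S M κ' u') N S M κ u)) K) x z (Sum.inl α) (Sum.inl β)
      - (1 / 2 : ℝ) * mmRead N (comp (comp K (dM (K2OfK K N S M κ u) N S M κ' u')) K) x z (Sum.inl α) (Sum.inl β) :=
    fun u' x z => K3OfK_W2SymOfK_zero_ff hK hmix hresp κ u κ' u' x z α β
  -- pair summability of the value part and its pair sums
  have hpV : ∀ u', Summable fun xz : Site (d + 1) × Site (d + 1) =>
      mmRead N (K3OfK K N S M (W2SymOfK K N S M 0 M₂) κ u κ' u') xz.1 xz.2 (Sum.inl α) (Sum.inl β) := by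
    intro u'
    have h := ((((hpE₁ u').add (hpE₂ u')).sub (hpX₁ u')).sub (hpX₂ u')).sub (((hpR₁ u').mul_left (1 / 2 : ℝ)).add
      ((hpR₂ u').mul_left (1 / 2 : ℝ)))
    refine h.congr fun xz => ?_
    rw [hv u' xz.1 xz.2]
    ring
  have hsum : ∀ u', (∑' xz : Site (d + 1) × Site (d + 1),
        mmRead N (K3OfK K N S M (W2SymOfK K N S M 0 M₂) κ u κ' u') xz.1 xz.2 (Sum.inl α) (Sum.inl β))
      = (∑' xz : Site (d + 1) × Site (d + 1),
          mmRead N (comp (comp K (dM K N S M κ u)) (comp (comp K (dM K N S M κ' u')) K)) xz.1 xz.2 (Sum.inl α) (Sum.inl β))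
      + (∑' xz : Site (d + 1) × Site (d + 1),
          mmRead N (comp (comp K (dM K N S M κ' u')) (comp (comp K (dM K N S M κ u)) K)) xz.1 xz.2 (Sum.inl α) (Sum.inl β))
      - (∑' xz : Site (d + 1) × Site (d + 1),
          mmRead N (comp (comp K (mixOfK K N M₂ κ u κ' u')) K) xz.1 xz.2 (Sum.inl α) (Sum.inl β))
      - (∑' xz : Site (d + 1) × Site (d + 1),
          mmRead N (comp (comp K (mixOfK K N M₂ κ' u' κ u)) K) xz.1 xz.2 (Sum.inl α) (Sum.inl β))
      - (1 / 2 : ℝ) * (∑' xz : Site (d + 1) × Site (d + 1),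
          mmRead N (comp (comp K (dM (K2OfK K N S M κ' u') N S M κ u)) K) xz.1 xz.2 (Sum.inl α) (Sum.inl β))
      - (1 / 2 : ℝ) * (∑' xz : Site (d + 1) × Site (d + 1),
          mmRead N (comp (comp K (dM (K2OfK K N S M κ u) N S M κ' u')) K) xz.1 xz.2 (Sum.inl α) (Sum.inl β)) := by
    intro u'
    rw [← tsum_mul_left, ← tsum_mul_left, ← (hpE₁ u').tsum_add (hpE₂ u'), ← ((hpE₁ u').add (hpE₂ u')).tsum_sub (hpX₁ u'),
      ← (((hpE₁ u').add (hpE₂ u')).sub (hpX₁ u')).tsum_sub (hpX₂ u'),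
      ← ((((hpE₁ u').add (hpE₂ u')).sub (hpX₁ u')).sub (hpX₂ u')).tsum_sub ((hpR₁ u').mul_left (1 / 2 : ℝ)),
      ← (((((hpE₁ u').add (hpE₂ u')).sub (hpX₁ u')).sub (hpX₂ u')).sub ((hpR₁ u').mul_left (1 / 2 : ℝ))).tsum_sub
        ((hpR₂ u').mul_left (1 / 2 : ℝ))]
    exact tsum_congr fun xz => hv u' xz.1 xz.2
  -- the bond series
  have hzV : HasSum (fun u' => ∑' xz : Site (d + 1) × Site (d + 1),
      mmRead N (K3OfK K N S M (W2SymOfK K N S M 0 M₂) κ u κ' u') xz.1 xz.2 (Sum.inl α) (Sum.inl β)) 0 := by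
    have h := (((hzE₁.add hzE₂).sub hzX₁).sub hzX₂).sub ((hzR₁.mul_left (1 / 2 : ℝ)).add (hzR₂.mul_left (1 / 2 : ℝ)))
    simp only [add_zero, sub_zero, mul_zero] at h
    refine h.congr_fun fun u' => ?_
    rw [hsum u']
    ring
  exact inner_eq_zero_of_hasSum_pair hpV hzV

end Assembly

/-! ## §5 The sandwich transfer: ff double-leg bond sums of a localised bond family ⟹ the sandwiched pair currency of §4 -/

section Transfer

variable [NeZero N] {K : MKer (d + 1) (Fib d)} {C δ : ℝ}

/-- [folklore] **SANDWICH TRANSFER.**  Let `K` decay (rate `δ > 0`) with SITE-FREE coarse-leg charges of leaf-06's `Sum.elim` shape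
(`−δ_{aα}·sL` ∕ `0` on the rows against `inr α`, `+δ_{bβ}·sR` ∕ `0` on the columns against `inr β` — the shape of
`StepResolventLegCharges.hasSum_KInvStep_row/col` after dressing), and let `u′ ↦ V u′` be a bond family of LOCALISED kernels whose
field–field double-leg sums have bond series with `HasSum` zero: `HasSum (u′ ↦ Σ'_{(y,w)} V u′ y w (inl α) (inl β)) 0`.  Then the sandwiched,
`mm`-read family `u′ ↦ mmRead N (K ∘ V u′ ∘ K) · · (inl α) (inl β)` is pair-summable at every bond and its bond series of pair sums has
`HasSum` zero (leaf-06's `ResolventLegCharges.hasSum_sandwich_readout` + `StepResolventLegCharges.sum_elim_charges`). -/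
theorem sandwich_transfer (hK : Decays K C δ) (hδ : 0 < δ) (α β : Fin (d + 1)) {sL sR : ℝ}
    (hrow : ∀ (f : Fib d) (y : Site (d + 1)), HasSum (fun x' : Site (d + 1) => K ((N : ℤ) • x') y (Sum.inr α) f)
      (Sum.elim (fun a => -(if a = α then sL else 0)) (fun _ => (0 : ℝ)) f))
    (hcol : ∀ (g : Fib d) (w : Site (d + 1)), HasSum (fun z' : Site (d + 1) => K w ((N : ℤ) • z') g (Sum.inr β))
      (Sum.elim (fun b => if b = β then sR else 0) (fun _ => (0 : ℝ)) g))
    {V : Site (d + 1) → MKer (d + 1) (Fib d)} (hV : ∀ u', Loc (V u'))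
    (hV0 : HasSum (fun u' : Site (d + 1) => ∑' yw : Site (d + 1) × Site (d + 1), V u' yw.1 yw.2 (Sum.inl α) (Sum.inl β)) 0) :
    (∀ u', Summable fun xz : Site (d + 1) × Site (d + 1) =>
        mmRead N (comp (comp K (V u')) K) xz.1 xz.2 (Sum.inl α) (Sum.inl β)) ∧
      HasSum (fun u' : Site (d + 1) => ∑' xz : Site (d + 1) × Site (d + 1),
        mmRead N (comp (comp K (V u')) K) xz.1 xz.2 (Sum.inl α) (Sum.inl β)) 0 := by
  -- the read-out of each member
  have hR : ∀ u', HasSum (fun xz : Site (d + 1) × Site (d + 1) =>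
        mmRead N (comp (comp K (V u')) K) xz.1 xz.2 (Sum.inl α) (Sum.inl β))
      (-(sL * sR) * ∑' yw : Site (d + 1) × Site (d + 1), V u' yw.1 yw.2 (Sum.inl α) (Sum.inl β)) := by
    intro u'
    obtain ⟨p, q, Cv, δv, hδv, hVb⟩ := hV u'
    have h := ResolventLegCharges.hasSum_sandwich_readout (N := N) hK hδ hVb hδv α β hrow hcol
    simp_rw [StepResolventLegCharges.sum_elim_charges] at h
    rw [tsum_mul_left] at h
    simpa only [mmRead_inl_inl] using h
  refine ⟨fun u' => (hR u').summable, ?_⟩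
  have h0 := hV0.mul_left (-(sL * sR))
  rw [mul_zero] at h0
  exact h0.congr_fun fun u' => (hR u').tsum_eq

end Transfer


end Summit.QuantumFields.BalabanUV.Beta.GAN24.WSlotSourceZeroMode

end
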